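import Mathlib
import Summits.MatrixMultiplication.MatrixMultiplication.Theorems.FourierTwoFamiliesModPPrimeTwoFamiliesEvalSpanEngine
import Summits.MatrixMultiplication.MatrixMultiplication.Theorems.FourierTwoFamiliesModPPrimeTwoFamiliesPaleyShiftCount
import Summits.MatrixMultiplication.MatrixMultiplication.Theorems.FourierTwoFamiliesModPPrimeTwoFamiliesPaleyCardSq
import Summits.MatrixMultiplication.MatrixMultiplication.Theorems.FourierTwoFamiliesModPPrimeTwoFamiliesPaleyCardNonsq

/-!
# Alon–Blokhuis minus one: `|W| ≤ ((q-1)/2)^n` for Paley–Sperner codes, `q ≡ 3 (mod 4)` prime, `q ≥ 7`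

Crux `PrimeTwoFamilies` (stmt-MatrixMultiplication-14308, route `FourierTwoFamiliesModP`), line `Sketch`, stub
`stub_paleyCapacity` = "the Sperner capacity of the Paley tournaments `P_q` (`q ≡ 3 (mod 4)` prime) is `(1-o(1)) log q`".
Known in print: `½ log q ≤ Σ(P_q) ≤ log((q+1)/2)` (the anti-diagonal words `(x,-x)`; Alon 1998 / Blokhuis 1993 out-degree
bound, in tree as `Literature.Combinatorics.Extremal.card_le_pow_of_paley_sperner`).  This file (lead c4) lowers the
ceiling by one in the base, `N(q, n) ≤ ((q-1)/2)^n` for every prime `q ≡ 3 (mod 4)`, `q ≥ 7`, by a RANK CERTIFICATE OVER A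
FINITE FIELD instead of a polynomial-degree count:

* Haemers-type principle (`card_le_card_pow_of_vanishing_frequencies`, via the engine `card_le_pow_of_eval_span`,
  p173048): if `ψ` is an additive character of `ZMod q` into a field `F` and `K ⊆ ZMod q` satisfies `(|K| : F) ≠ 0` and
  `∑_{k∈K} ψ(k d) = 0` for every non-zero square `d`, then `N(q,n) ≤ |K|^n` (the circulant matrix `f(b-a)`,
  `f = ∑_{k∈K} ψ(k·)`, has rank `≤ |K|`, non-zero diagonal, and vanishes on square differences; its Kronecker powers
  restrict to diagonal matrices on any Paley–Sperner code).
* `card_le_pow_half_of_paley_sperner`: with `ℓ` a prime factor of `(q+1)/4` and `F = 𝔽̄_ℓ`, the Gauss periods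
  `η_S, η_N` (sums of `ψ` over the non-zero squares / the non-squares) satisfy `η_S + η_N = -1` and
  `η_S η_N = (q-1)/2 - (q-3)/4 = (q+1)/4 = 0` (the squares are a `(q,(q-1)/2,(q-3)/4)` difference set:
  `paley_shiftCount`, p173352), so one of them vanishes and `K =` squares, resp. non-squares (`|K| = (q-1)/2`, prime
  to `ℓ`; `paley_card_sq` p173471, `paley_card_nonsq` p173553) is a certificate.
* `card_le_pow_half_of_paley_sperner_fin`: the `Fin q`-valued vocabulary of the stub; and the sharp case
  `card_le_three_pow_of_paley_seven_sperner`: `Σ(P_7) = log 3` (the transitive triangle `{0,1,2}` gives the matching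
  lower bound), the first Paley tournament beyond the cyclic triangle whose Sperner capacity is determined.

Computations behind the choice of certificate (lead c4, folder calc/): over prime fields `F_ℓ`, `ℓ ≤ 80`, the minimum
rank of such circulant certificates is EXACTLY `(q-1)/2` for `q = 7, 11, 19, 23` (attained iff `ℓ ∣ (q+1)/4`), and no
single-coset certificate `K = μ_d`, `d < (q-1)/2`, exists for `q ≤ 139`; so `stub_paleyCapacity` is untouched in
exponent, but the rank functional `min_F minrank_F(P_q^{×L})^{1/L}` is now the line's kill instrument for it.
-/

set_option linter.dupNamespace false

namespace Summit.MatrixMultiplication.MatrixMultiplication.Theorems.PrimeTwoFamilies.PaleyRankBound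

open Finset

/-! ## The certificate -/

/-- **The rank certificate, abstract form.**  Let `ψ` be an additive character of `ZMod q` into a field
`F` and `K` a finite set of "frequencies" such that `(|K| : F) ≠ 0` and the character sum
`∑_{k ∈ K} ψ (k d)` vanishes for every non-zero square `d`.  Then every Paley–Sperner code of length `n`
has at most `|K|^n` words: the functions `x ↦ ∏_i ∑_{k ∈ K} ψ (k (x_i - u_i))` (one per word `u`) are
linearly independent and lie in the `|K|^n`-dimensional span of the products of the characters
`x ↦ ψ (k x)`, `k ∈ K`. -/
theorem card_le_card_pow_of_vanishing_frequencies {q : ℕ} [NeZero q] {F : Type*} [Field F]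
    (ψ : AddChar (ZMod q) F) (K : Finset (ZMod q)) (hK0 : ((K.card : ℕ) : F) ≠ 0)
    (hKvan : ∀ d : ZMod q, d ≠ 0 → IsSquare d → ∑ k ∈ K, ψ (k * d) = 0)
    {n : ℕ} (S : Finset (Fin n → ZMod q))
    (hS : ∀ u ∈ S, ∀ v ∈ S, u ≠ v → ∃ i, u i ≠ v i ∧ IsSquare (v i - u i)) :
    S.card ≤ K.card ^ n := by
  classical
  let b : ↥K → ZMod q → F := fun k x => ψ ((k : ZMod q) * x)
  let f : (Fin n → ZMod q) → Fin n → ZMod q → F := fun u i x => ∑ k ∈ K, ψ (k * (x - u i))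
  have h := card_le_pow_of_eval_span b S f ?_ ?_ ?_
  · simpa [Fintype.card_coe] using h
  · intro u _ i
    refine ⟨fun k => ψ (-((k : ZMod q) * u i)), fun x => ?_⟩
    simp only [f, b]
    rw [← Finset.sum_coe_sort K]
    refine Finset.sum_congr rfl fun k _ => ?_
    rw [← AddChar.map_add_eq_mul]
    congr 1
    ring
  · intro u _ i
    simp only [f, sub_self, mul_zero, AddChar.map_zero_eq_one, Finset.sum_const, nsmul_eq_mul,
      mul_one]
    exact hK0
  · intro u hu v hv hne
    obtain ⟨i, hne_i, hsq⟩ := hS u hu v hv hne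
    exact ⟨i, hKvan _ (sub_ne_zero.mpr (Ne.symm hne_i)) hsq⟩

/-- **The Gauss-period certificate.**  For a prime `q ≥ 7`, `q ≡ 3 (mod 4)`, there are a prime `ℓ`, an
additive character `ψ` of `ZMod q` into `𝔽̄_ℓ` and a set `K` of `(q-1)/2` frequencies, `(|K| : 𝔽̄_ℓ) ≠ 0`,
whose character sums `∑_{k∈K} ψ(k d)` vanish at every non-zero square `d`.

Proof.  Take a prime `ℓ ∣ (q+1)/4` and a primitive `q`-th root of unity `ζ` in characteristic `ℓ`
(`F = 𝔽̄_ℓ`), `ψ(x) = ζ^x`.  The Gauss periods `η_S = ∑_{s square ≠ 0} ψ s`, `η_N = ∑_{t non-square} ψ t`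
satisfy `η_S + η_N = -1` and — since the non-zero squares form a `(q, (q-1)/2, (q-3)/4)` difference set
(`paley_shiftCount`) — `η_S η_N = (q-1)/2 - (q-3)/4 = (q+1)/4 = 0` in `F`.  So `η_S = 0` or `η_N = 0`;
with `K` the non-zero squares, resp. the non-squares, `∑_{k ∈ K} ψ(k d) = η_K = 0` for every non-zero
square `d` (multiplication by `d` permutes `K`), while `|K| = (q-1)/2` is prime to `ℓ`.  The abstract
certificate `card_le_card_pow_of_vanishing_frequencies` finishes.  This lemma isolates the number theory:
the EXISTENCE of such a certificate `(ℓ, ψ, K)` with `|K| = (q-1)/2`. -/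
theorem exists_paley_vanishing_frequencies {q : ℕ} [hq : Fact q.Prime] (hq3 : q % 4 = 3) (hq7 : 7 ≤ q) :
    ∃ (ℓ : ℕ) (_ : Fact ℓ.Prime) (ψ : AddChar (ZMod q) (AlgebraicClosure (ZMod ℓ))) (K : Finset (ZMod q)),
      K.card = q / 2 ∧ ((K.card : ℕ) : AlgebraicClosure (ZMod ℓ)) ≠ 0 ∧
      ∀ d : ZMod q, d ≠ 0 → IsSquare d → ∑ k ∈ K, ψ (k * d) = 0 := by
  classical
  -- arithmetic of `q = 4m + 3`
  obtain ⟨m, hm⟩ : ∃ m, q = 4 * m + 3 := ⟨q / 4, by omega⟩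
  have hq2 : q / 2 = 2 * m + 1 := by omega
  have hq4 : q / 4 = m := by omega
  -- a prime `ℓ ∣ m + 1 = (q+1)/4`
  have hm1 : m + 1 ≠ 1 := by omega
  obtain ⟨ℓ, hℓ, hℓm⟩ := Nat.exists_prime_and_dvd hm1
  haveI : Fact ℓ.Prime := ⟨hℓ⟩
  have hℓq : ¬ ℓ ∣ q := by
    intro h
    have h1 := (Nat.prime_dvd_prime_iff_eq hℓ hq.out).1 h
    have h2 : ℓ ≤ m + 1 := Nat.le_of_dvd (Nat.succ_pos _) hℓm
    omega
  have hℓodd : ¬ ℓ ∣ 2 * m + 1 := by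
    intro h
    have h2 : ℓ ∣ 2 * (m + 1) := Dvd.dvd.mul_left hℓm 2
    have h3 : ℓ ∣ 2 * (m + 1) - (2 * m + 1) := Nat.dvd_sub h2 h
    have h4 : 2 * (m + 1) - (2 * m + 1) = 1 := by omega
    rw [h4] at h3
    exact hℓ.one_lt.ne' (Nat.dvd_one.1 h3)
  -- the field `F = 𝔽̄_ℓ`, casts of naturals
  let F := AlgebraicClosure (ZMod ℓ)
  have hcastF : ∀ a : ℕ, algebraMap (ZMod ℓ) F (a : ZMod ℓ) = (a : F) :=
    fun a => map_natCast (algebraMap (ZMod ℓ) F) a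
  have hzeroF : ∀ a : ℕ, ℓ ∣ a → (a : F) = 0 := fun a h => by
    rw [← hcastF, (ZMod.natCast_eq_zero_iff a ℓ).2 h, map_zero]
  have hneF : ∀ a : ℕ, ¬ ℓ ∣ a → (a : F) ≠ 0 := fun a h h0 => by
    rw [← hcastF, map_eq_zero] at h0
    exact h ((ZMod.natCast_eq_zero_iff a ℓ).1 h0)
  -- a primitive `q`-th root of unity and the additive character `ψ x = ζ^x`
  haveI : NeZero (q : ZMod ℓ) := ⟨fun h => hℓq ((ZMod.natCast_eq_zero_iff q ℓ).1 h)⟩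
  obtain ⟨ζ, hζ⟩ := HasEnoughRootsOfUnity.exists_primitiveRoot F q
  haveI : NeZero q := ⟨hq.out.ne_zero⟩
  let ψ : AddChar (ZMod q) F := AddChar.zmodChar q hζ.pow_eq_one
  have hψ1 : ψ ≠ 1 := by
    intro h
    have h1 : ψ ((1 : ℕ) : ZMod q) = ζ := by
      rw [AddChar.zmodChar_apply', pow_one]
    rw [h, AddChar.one_apply] at h1
    exact hζ.ne_one hq.out.one_lt h1.symm
  have hsum0 : ∑ a, ψ a = 0 := AddChar.sum_eq_zero_of_ne_one hψ1
  -- the squares and the non-squares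
  let Sq : Finset (ZMod q) := univ.filter fun s => s ≠ 0 ∧ IsSquare s
  let Nq : Finset (ZMod q) := univ.filter fun s => ¬ IsSquare s
  have hSq : Sq.card = q / 2 := paley_card_sq hq3
  have hNq : Nq.card = q / 2 := paley_card_nonsq hq3
  have hm1sq : ¬ IsSquare (-1 : ZMod q) := by
    rw [ZMod.exists_sq_eq_neg_one_iff]; omega
  -- multiplication by a non-zero square preserves (non-)squareness
  have hmulsq : ∀ d k : ZMod q, d ≠ 0 → IsSquare d → (IsSquare (k * d) ↔ IsSquare k) := by
    intro d k hd hdsq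
    constructor
    · intro h
      have : k = k * d * d⁻¹ := by field_simp
      rw [this]
      exact h.mul (isSquare_inv.mpr hdsq)
    · intro h
      exact h.mul hdsq
  -- the Gauss periods
  set ηS := ∑ s ∈ Sq, ψ s with hηS
  set ηN := ∑ s ∈ Nq, ψ s with hηN
  -- (1) `1 + η_S + η_N = 0`
  have hsq_insert : (univ.filter fun a : ZMod q => IsSquare a) = insert 0 Sq := by
    ext a
    simp only [Sq, mem_filter, mem_univ, true_and, mem_insert]
    constructor
    · intro h
      by_cases ha : a = 0
      · exact Or.inl ha
      · exact Or.inr ⟨ha, h⟩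
    · rintro (rfl | ⟨_, h⟩)
      · exact IsSquare.zero
      · exact h
  have h0Sq : (0 : ZMod q) ∉ Sq := by simp [Sq]
  have hper1 : 1 + ηS + ηN = 0 := by
    have h := (Finset.sum_filter_add_sum_filter_not univ (fun a : ZMod q => IsSquare a) ψ)
    rw [hsum0, hsq_insert, Finset.sum_insert h0Sq, AddChar.map_zero_eq_one] at h
    simpa [hηS, hηN, Sq, Nq, add_assoc] using h
  -- (2) `η_S η_N = (q+1)/4 = 0` in `F`
  have hcount0 : (Sq.filter fun s => ¬ IsSquare (0 - s)).card = 2 * m + 1 := by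
    rw [← hq2, ← hSq]
    congr 1
    refine Finset.filter_true_of_mem fun s hs => ?_
    simp only [Sq, mem_filter, mem_univ, true_and] at hs
    intro hneg
    rw [zero_sub] at hneg
    apply hm1sq
    have : (-1 : ZMod q) = -s * s⁻¹ := by field_simp [hs.1]
    rw [this]
    exact hneg.mul (isSquare_inv.mpr hs.2)
  have hcountk : ∀ k : ZMod q, k ≠ 0 → (Sq.filter fun s => ¬ IsSquare (k - s)).card = m := by
    intro k hk
    rw [← hq4, ← paley_shiftCount hq3 k hk, Finset.filter_filter]
    congr 1
    refine Finset.filter_congr fun s _ => ?_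
    tauto
  have hper2 : ηS * ηN = ((m + 1 : ℕ) : F) := by
    -- expand the product and substitute `t = k - s`
    have hexp : ηS * ηN = ∑ s ∈ Sq, ∑ k ∈ univ.filter (fun k => ¬ IsSquare (k - s)), ψ k := by
      rw [hηS, hηN, Finset.sum_mul_sum]
      refine Finset.sum_congr rfl fun s _ => ?_
      refine Finset.sum_nbij' (fun t => s + t) (fun k => k - s) ?_ ?_ ?_ ?_ ?_
      · intro t ht
        simp only [Nq, mem_filter, mem_univ, true_and] at ht ⊢
        simpa using ht
      · intro k hk
        simp only [Nq, mem_filter, mem_univ, true_and] at hk ⊢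
        exact hk
      · intro t _; simp
      · intro k _; simp
      · intro t _
        rw [AddChar.map_add_eq_mul]
    -- swap the sums and count
    have hswap : ∑ s ∈ Sq, ∑ k ∈ univ.filter (fun k => ¬ IsSquare (k - s)), ψ k =
        ∑ k, ((Sq.filter fun s => ¬ IsSquare (k - s)).card : F) * ψ k := by
      simp_rw [Finset.sum_filter]
      rw [Finset.sum_comm]
      refine Finset.sum_congr rfl fun k _ => ?_
      rw [← Finset.sum_filter, Finset.sum_const, nsmul_eq_mul]
    rw [hexp, hswap, ← Finset.add_sum_erase _ _ (mem_univ (0 : ZMod q)), AddChar.map_zero_eq_one,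
      mul_one]
    have hrest : ∑ k ∈ univ.erase (0 : ZMod q), ((Sq.filter fun s => ¬ IsSquare (k - s)).card : F) * ψ k =
        (m : F) * ∑ k ∈ univ.erase (0 : ZMod q), ψ k := by
      rw [Finset.mul_sum]
      refine Finset.sum_congr rfl fun k hk => ?_
      rw [hcountk k (Finset.ne_of_mem_erase hk)]
    have herase : ∑ k ∈ univ.erase (0 : ZMod q), ψ k = -1 := by
      have h := Finset.add_sum_erase univ ψ (mem_univ (0 : ZMod q))
      rw [hsum0, AddChar.map_zero_eq_one] at h
      linear_combination h
    have hc0 : (((Sq.filter fun s => ¬ IsSquare (0 - s)).card : ℕ) : F) = (m : F) + (m : F) + 1 := by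
      rw [hcount0, two_mul]; simp only [Nat.cast_add, Nat.cast_one]
    rw [hrest, herase, hc0]
    push_cast
    ring
  have hper0 : ηS * ηN = 0 := by rw [hper2]; exact hzeroF _ hℓm
  -- (3) one of the periods vanishes; either way a certificate with `|K| = (q-1)/2`
  have hK0 : (((q / 2 : ℕ) : ℕ) : F) ≠ 0 := by rw [hq2]; exact hneF _ hℓodd
  rcases mul_eq_zero.1 hper0 with hS0 | hN0
  · -- `η_S = 0`: frequencies = the non-zero squares
    refine ⟨ℓ, ⟨hℓ⟩, ψ, Sq, hSq, hSq ▸ hK0, fun d hd hdsq => ?_⟩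
    rw [← hS0, hηS]
    refine Finset.sum_nbij' (fun k => k * d) (fun k => k * d⁻¹) ?_ ?_ ?_ ?_ ?_
    · intro k hk
      simp only [Sq, mem_filter, mem_univ, true_and] at hk ⊢
      exact ⟨mul_ne_zero hk.1 hd, (hmulsq d k hd hdsq).2 hk.2⟩
    · intro k hk
      simp only [Sq, mem_filter, mem_univ, true_and] at hk ⊢
      refine ⟨mul_ne_zero hk.1 (inv_ne_zero hd), ?_⟩
      rw [← hmulsq d _ hd hdsq]
      have : k * d⁻¹ * d = k := by field_simp
      rw [this]; exact hk.2
    · intro k _; field_simp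
    · intro k _; field_simp
    · intro k _; rfl
  · -- `η_N = 0`: frequencies = the non-squares
    refine ⟨ℓ, ⟨hℓ⟩, ψ, Nq, hNq, hNq ▸ hK0, fun d hd hdsq => ?_⟩
    rw [← hN0, hηN]
    refine Finset.sum_nbij' (fun k => k * d) (fun k => k * d⁻¹) ?_ ?_ ?_ ?_ ?_
    · intro k hk
      simp only [Nq, mem_filter, mem_univ, true_and] at hk ⊢
      rwa [hmulsq d k hd hdsq]
    · intro k hk
      simp only [Nq, mem_filter, mem_univ, true_and] at hk ⊢
      rw [← hmulsq d _ hd hdsq]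
      have : k * d⁻¹ * d = k := by field_simp
      rwa [this]
    · intro k _; field_simp
    · intro k _; field_simp
    · intro k _; rfl

/-- **Alon–Blokhuis minus one for the Paley tournaments.**  Let `q ≥ 7` be a prime, `q ≡ 3 (mod 4)`,
and `S ⊆ (ZMod q)^n` a set of words in which every ordered pair of distinct words `(u, v)` has a
coordinate `i` with `v i - u i` a non-zero square.  Then `|S| ≤ ((q-1)/2)^n` — one less, in the base,
than the out-degree bound `((q+1)/2)^n` (Alon 1998 / Blokhuis 1993): the certificate of
`exists_paley_vanishing_frequencies` fed to `card_le_card_pow_of_vanishing_frequencies`.  For `q = 7`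
(`ℓ = 2`) the bound `3^n` is sharp: `Σ(P_7) = log 3`. -/
theorem card_le_pow_half_of_paley_sperner {q : ℕ} [hq : Fact q.Prime] (hq3 : q % 4 = 3) (hq7 : 7 ≤ q)
    {n : ℕ} (S : Finset (Fin n → ZMod q))
    (hS : ∀ u ∈ S, ∀ v ∈ S, u ≠ v → ∃ i, u i ≠ v i ∧ IsSquare (v i - u i)) :
    S.card ≤ (q / 2) ^ n := by
  obtain ⟨ℓ, hℓ, ψ, K, hK, hK0, hvan⟩ := exists_paley_vanishing_frequencies hq3 hq7
  haveI : NeZero q := ⟨hq.out.ne_zero⟩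
  rw [← hK]
  exact card_le_card_pow_of_vanishing_frequencies ψ K hK0 hvan S hS

/-- The same bound in the `Fin q`-valued vocabulary of `stub_paleyCapacity` (crux work-file
`Cruxes/PrimeTwoFamilies/Lines/Sketch.lean`): `|W| ≤ ((q-1)/2)^n` for every set `W ⊆ (Fin q)^n` of words
pairwise separated, in both orders, by a non-zero square difference in some coordinate. -/
theorem card_le_pow_half_of_paley_sperner_fin {q : ℕ} [hq : Fact q.Prime] (hq3 : q % 4 = 3) (hq7 : 7 ≤ q)
    {n : ℕ} (W : Finset (Fin n → Fin q))
    (hW : ∀ u ∈ W, ∀ w ∈ W, u ≠ w →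
      ∃ t : Fin n, u t ≠ w t ∧ IsSquare (((w t : ℕ) : ZMod q) - ((u t : ℕ) : ZMod q))) :
    W.card ≤ (q / 2) ^ n := by
  classical
  let φ : (Fin n → Fin q) → (Fin n → ZMod q) := fun w t => ((w t : ℕ) : ZMod q)
  have hcast : ∀ a b : Fin q, ((a : ℕ) : ZMod q) = ((b : ℕ) : ZMod q) → a = b := by
    intro a b h
    apply Fin.ext
    have := (ZMod.natCast_eq_natCast_iff' a b q).mp h
    rwa [Nat.mod_eq_of_lt a.isLt, Nat.mod_eq_of_lt b.isLt] at this
  have hφ : Function.Injective φ := fun a b h => funext fun t => hcast _ _ (congrFun h t)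
  rw [← Finset.card_image_of_injective W hφ]
  refine card_le_pow_half_of_paley_sperner hq3 hq7 (W.image φ) ?_
  simp only [Finset.mem_image]
  rintro _ ⟨u, hu, rfl⟩ _ ⟨w, hw, rfl⟩ hne
  have hne' : u ≠ w := fun e => hne (by rw [e])
  obtain ⟨t, ht, hsq⟩ := hW u hu w hw hne'
  exact ⟨t, fun e => ht (hcast _ _ e), hsq⟩

/-- **`Σ(P_7) = log 3`.**  A set of words over `Fin 7` in which every ordered pair of distinct words is
separated by a non-zero-square difference (mod 7) in some coordinate has at most `3^n` words.  The bound is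
attained in exponent by the antichains of `{0,1,2}^n` (`0 → 1 → 2 → 0+…`: `1, 2` are squares mod 7), so the
Sperner capacity of the Paley tournament `P_7` is exactly `log 3` — strictly between `½ log 7` and Alon's
`log 4`. -/
theorem card_le_three_pow_of_paley_seven_sperner {n : ℕ} (W : Finset (Fin n → Fin 7))
    (hW : ∀ u ∈ W, ∀ w ∈ W, u ≠ w →
      ∃ t : Fin n, u t ≠ w t ∧ IsSquare (((w t : ℕ) : ZMod 7) - ((u t : ℕ) : ZMod 7))) :
    W.card ≤ 3 ^ n := by
  haveI : Fact (Nat.Prime 7) := ⟨by norm_num⟩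
  exact card_le_pow_half_of_paley_sperner_fin (q := 7) (by norm_num) le_rfl W hW

end Summit.MatrixMultiplication.MatrixMultiplication.Theorems.PrimeTwoFamilies.PaleyRankBound
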